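import Mathlib
import Summits.PneNP.PneNP.Theses.OneSlice
import Summits.PneNP.PneNP.Theorems.OneSliceSliceTargetSplit
import Summits.PneNP.PneNP.Theorems.OneSliceMonotoneContinuationDefs
import Summits.PneNP.PneNP.Theorems.OneSliceMonotoneContinuationTransportMono
import Summits.PneNP.PneNP.Theorems.OneSliceMonotoneContinuationLevelAverage
import Summits.PneNP.PneNP.Theorems.OneSliceMonotoneContinuationSamplerExpansion
import Summits.PneNP.PneNP.Theorems.OneSliceMonotoneContinuationBinomialMixing
import Summits.PneNP.PneNP.Theorems.OneSliceMonotoneContinuationSamplerCircuit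
import Summits.PneNP.PneNP.Theorems.OneSliceMonotoneContinuationWindow

/-!
# Route OneSlice, crux `MonotoneContinuation` (stmt-PneNP-18471), line `Sketch_ideator1_r1` (ProfileLine) — the composition core

`mc_core` / `mcCore`: relative to a class `P` of instances `(n, j, C)`, the residual of the line (a slice-faithful small monotone
representative with a one-sided flat profile) implies the conclusion of the crux on `P`. Proof: contraction of the transport,
the sampling mean (`exists_mean`, window Chebyshev), the matching deletion/padding sampler (`exists_sampler`, landed
`stub_samplerCircuit`), derandomized majority (`circuit_of_sampler`), eventual facts; accuracy `25u ≤ η` with `u = η/100`.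

Lead prover-line-stmt-PneNP-18471-0, 2026-08-17. Def-free (vocabulary in `OneSliceMonotoneContinuationDefs.lean`).
-/

set_option linter.dupNamespace false -- `Summit.PneNP.PneNP.…`: summit = sub-problem (D-0017)

namespace Summit.PneNP.PneNP.Theorems.MonotoneContinuation

open Literature.Computability.Complexity hiding supp mem_supp
open Finset hiding slice
open Filter hiding mem_sdiff
open Classical
open Summit.PneNP.PneNP.Theorems (binomialWeight_tail_le binomialWeight_sum_range binomialWeight_nonneg card_slice
  tendsto_mean eventually_window central_add_le mean_ge)
open Summit.PneNP.PneNP.Theorems.ConstantBand.Negative (Edge thr Central slice)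
open Summit.PneNP.PneNP.Theorems.SingleThreshold.Negative (pc tendsto_pc pc_nonneg)
open Summit.PneNP.PneNP.Theorems.SliceTargetSplit (Comp nbhd mem_nbhd transport ind l1 nbhdCard ind_nonneg ind_le_one
  abs_ind_sub_ind l1_comm l1_nonneg l1_triangle l1_eq_sum_slices card_nbhd card_nbhd_of_le card_nbhd_of_ge
  choose_mul_nbhdCard nbhdCard_pos sum_slice_sum_nbhd sum_slice_sum_nbhd_left transport_nonneg transport_sub
  l1_transport_le rdist_eq_l1 transport_ind_mem)

noncomputable section

variable {n : ℕ}

/-! ## The composition -/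

/-- **The sampling mean.** Under one-sided flatness over `2w` slices, the binomial average of the profile increments
around the mean `j + w` (flat above) resp. `j - w` (flat below) is at most `u + (j+w)/w²`. -/
theorem exists_mean {f : (Edge n → Bool) → Bool} (hf : Monotone f)
    {j w : ℕ} (hjN : j ≤ n.choose 2) (hj2w : j + 2 * w ≤ n.choose 2) (hwj : w ≤ j) (hw1 : 1 ≤ w)
    {u : ℝ} (hu0 : 0 ≤ u)
    (hflat : (∀ r : ℕ, r ≤ 2 * w → profile f (j + r) - profile f j ≤ u) ∨
      (∀ r : ℕ, r ≤ 2 * w → profile f j - profile f (j - r) ≤ u)) :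
    ∃ pstar : ℝ, 0 ≤ pstar ∧ pstar ≤ 1 ∧
      ∑ r ∈ range (n.choose 2 + 1), binW (n.choose 2) pstar r * |profile f r - profile f j| ≤
        u + ((j : ℝ) + w) / (w : ℝ) ^ 2 := by
  have hα1 : ∀ r, |profile f r - profile f j| ≤ 1 := fun r => abs_profile_sub_le f r j
  have hNpos : (0 : ℝ) < (n.choose 2 : ℕ) := by
    have : 1 ≤ n.choose 2 := by omega
    exact_mod_cast this
  have hwr : (0 : ℝ) < w := by exact_mod_cast hw1
  have hjNr : (j : ℝ) ≤ (n.choose 2 : ℕ) := by exact_mod_cast hjN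
  have hjwN : (j : ℝ) + w ≤ (n.choose 2 : ℕ) := by
    have : j + w ≤ n.choose 2 := by omega
    exact_mod_cast this
  have hwjr : (w : ℝ) ≤ j := by exact_mod_cast hwj
  rcases hflat with hup | hdown
  · -- flat above: mean `j + w`
    set pstar : ℝ := ((j : ℝ) + w) / (n.choose 2 : ℕ) with hps
    have hps0 : 0 ≤ pstar := by positivity
    have hps1 : pstar ≤ 1 := (div_le_one hNpos).2 hjwN
    have hmean : ((n.choose 2 : ℕ) : ℝ) * pstar = j + w := mul_div_cancel₀ _ hNpos.ne'
    refine ⟨pstar, hps0, hps1, ?_⟩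
    have hflat' : ∀ r, (j ≤ r ∧ r ≤ j + 2 * w) → |profile f r - profile f j| ≤ u := by
      rintro r ⟨hr1, hr2⟩
      have hmono : profile f j ≤ profile f r := profile_mono hf hr1 (by omega)
      rw [abs_of_nonneg (sub_nonneg.2 hmono)]
      have := hup (r - j) (by omega)
      rwa [Nat.add_sub_cancel' hr1] at this
    have htail' : ∀ r, ¬ (j ≤ r ∧ r ≤ j + 2 * w) → (w : ℝ) ≤ |(r : ℝ) - (n.choose 2 : ℕ) * pstar| := by
      intro r hr
      rw [hmean]
      rcases not_and_or.1 hr with h | h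
      · have h' : r + 1 ≤ j := by omega
        have : (r : ℝ) + 1 ≤ j := by exact_mod_cast h'
        rw [abs_of_neg (by linarith)]; linarith
      · have h' : j + 2 * w + 1 ≤ r := by omega
        have : (j : ℝ) + 2 * w + 1 ≤ r := by exact_mod_cast h'
        rw [abs_of_pos (by linarith)]; linarith
    refine (binAvg_le_of_flat hps0 hps1 hwr hu0 (profile f) hα1 _ hflat' htail').trans ?_
    rw [hmean]
    have : ((j : ℝ) + w) * (1 - pstar) / (w : ℝ) ^ 2 ≤ ((j : ℝ) + w) / (w : ℝ) ^ 2 := by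
      refine div_le_div_of_nonneg_right ?_ (by positivity)
      nlinarith
    linarith
  · -- flat below: mean `j - w`
    set pstar : ℝ := ((j : ℝ) - w) / (n.choose 2 : ℕ) with hps
    have hps0 : 0 ≤ pstar := div_nonneg (by linarith) hNpos.le
    have hps1 : pstar ≤ 1 := (div_le_one hNpos).2 (by linarith)
    have hmean : ((n.choose 2 : ℕ) : ℝ) * pstar = j - w := mul_div_cancel₀ _ hNpos.ne'
    refine ⟨pstar, hps0, hps1, ?_⟩
    have hflat' : ∀ r, (j - 2 * w ≤ r ∧ r ≤ j) → |profile f r - profile f j| ≤ u := by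
      rintro r ⟨hr1, hr2⟩
      have hmono : profile f r ≤ profile f j := profile_mono hf hr2 hjN
      rw [abs_sub_comm, abs_of_nonneg (sub_nonneg.2 hmono)]
      have := hdown (j - r) (by omega)
      rwa [Nat.sub_sub_self hr2] at this
    have htail' : ∀ r, ¬ (j - 2 * w ≤ r ∧ r ≤ j) → (w : ℝ) ≤ |(r : ℝ) - (n.choose 2 : ℕ) * pstar| := by
      intro r hr
      rw [hmean]
      rcases not_and_or.1 hr with h | h
      · have h' : r + 1 + 2 * w ≤ j := by omega
        have : (r : ℝ) + 1 + 2 * w ≤ j := by exact_mod_cast h'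
        rw [abs_of_neg (by linarith)]; linarith
      · have h' : j + 1 ≤ r := by omega
        have : (j : ℝ) + 1 ≤ r := by exact_mod_cast h'
        rw [abs_of_pos (by linarith)]; linarith
    refine (binAvg_le_of_flat hps0 hps1 hwr hu0 (profile f) hα1 _ hflat' htail').trans ?_
    rw [hmean]
    have : ((j : ℝ) - w) * (1 - pstar) / (w : ℝ) ^ 2 ≤ ((j : ℝ) + w) / (w : ℝ) ^ 2 := by
      refine div_le_div_of_nonneg_right ?_ (by positivity)
      nlinarith
    linarith

/-- **The sampler matching a mean.** Every `p* ∈ [0,1]` is the edge density of a deletion (`p* ≤ p`) or a padding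
(`p < p*`) of `G(n,p)`; the corresponding restriction sampler of a monotone circuit's function has majority votes
realised by monotone circuits (`SamplerCircuit`) and is within the binomial profile average of the transport. -/
theorem exists_sampler {t : ℕ} (ht : 0 < t) (hn2 : 2 ≤ n) {p : ℝ} (hp0 : 0 < p) (hp1 : p < 1)
    (C₁ : Circuit (Edge n)) (hC₁ : C₁.IsOver monotoneBasis) {j : ℕ} (hjN : j ≤ n.choose 2)
    {pstar : ℝ} (hps0 : 0 ≤ pstar) (hps1 : pstar ≤ 1) {B : ℝ}
    (hbin : ∑ r ∈ range (n.choose 2 + 1), binW (n.choose 2) pstar r * |profile C₁.eval r - profile C₁.eval j| ≤ B) :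
    ∃ (σ : (Edge n → Bool) → (Edge n → Bool) → (Edge n → Bool)) (r : ℝ), 0 ≤ r ∧ r ≤ 1 ∧
      (∀ ρs : Fin t → Edge n → Bool, ∃ M : Circuit (Edge n), M.IsOver monotoneBasis ∧
        M.size ≤ t * (C₁.size + 2 * n.choose 2 + 2) + 4 * t ^ 2 + 4 ∧
        ∀ y : Edge n → Bool, (∃ e, y e = false) → (∃ e, y e = true) →
          M.eval y = majVote (fun a y => C₁.eval (σ y (ρs a))) y) ∧
      l1 n p (fun y => ∑ ρ, gnpWeight n r ρ * ind C₁.eval (σ y ρ)) (transport j (ind C₁.eval)) ≤ B := by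
  have hf : Monotone C₁.eval := C₁.monotone_eval_of_isOver_monotoneBasis hC₁
  rcases le_or_gt pstar p with hle | hgt
  · -- deletion with keep-rate `p*/p`, i.e. `q = 1 - p*/p`
    set q : ℝ := 1 - pstar / p with hqdef
    have hq0 : 0 ≤ q := by rw [hqdef, sub_nonneg, div_le_one hp0]; exact hle
    have hq1 : q ≤ 1 := by rw [hqdef]; linarith [div_nonneg hps0 hp0.le]
    have hpq : p * (1 - q) = pstar := by rw [hqdef]; field_simp; ring
    refine ⟨meet, 1 - q, by linarith, by linarith, fun ρs => (stub_samplerCircuit n t hn2 ht C₁ hC₁ ρs).1, ?_⟩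
    have := l1_delSampler_le hp0.le hp1.le hq0 hq1 C₁.eval hf hjN
    rw [hpq] at this
    exact this.trans hbin
  · -- padding with rate `(p* - p)/(1 - p)`
    set q : ℝ := (pstar - p) / (1 - p) with hqdef
    have h1p : 0 < 1 - p := by linarith
    have hq0 : 0 ≤ q := div_nonneg (by linarith) h1p.le
    have hq1 : q ≤ 1 := by rw [hqdef, div_le_one h1p]; linarith
    have hpq : p + q - p * q = pstar := by
      rw [hqdef]; field_simp; ring
    refine ⟨join, q, hq0, hq1, fun ρs => (stub_samplerCircuit n t hn2 ht C₁ hC₁ ρs).2, ?_⟩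
    have := l1_padSampler_le hp0.le hp1.le hq0 hq1 C₁.eval hf hjN
    rw [hpq] at this
    exact this.trans hbin

/-- The two extreme inputs have mass `(1-p)^N + p^N`. -/
theorem gnpWeight_bot_add_top (p : ℝ) :
    gnpWeight n p (fun _ : Edge n => false) + gnpWeight n p (fun _ : Edge n => true) =
      (1 - p) ^ (n.choose 2) + p ^ (n.choose 2) := by
  have h0 : edgeCount (fun _ : Edge n => false) = 0 := by simp [edgeCount]
  have h1 : edgeCount (fun _ : Edge n => true) = n.choose 2 := by
    rw [edgeCount, ← card_edgeSet_top_fin n, ← card_univ]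
    congr 1; ext e; simp
  rw [gnpWeight, gnpWeight, h0, h1]; simp

/-- Final accounting, in a clean context. -/
theorem final_bound {x a b c u η : ℝ} (hudef : u = η / 100) (hη : 0 < η)
    (h1 : x ≤ a + b + (c + 5 * (3 * u + u)) + 3 * u) (hab : a + b ≤ u) (hc : c ≤ u) : x ≤ η := by
  rw [hudef] at h1 hab hc; linarith

/-- Window tail arithmetic, in a clean context: `(j + Ls)/(Ls)² ≤ 5/L` for `j ≤ 4s²`, `L, s ≥ 1`. -/
theorem tail_arith {j L s : ℕ} (hL1 : 1 ≤ L) (hs1 : 1 ≤ s) (hjs : (j : ℝ) ≤ 4 * (s : ℝ) ^ 2) :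
    ((j : ℝ) + (L * s : ℕ)) / ((L * s : ℕ) : ℝ) ^ 2 ≤ 5 / L := by
  have hLr1 : (1 : ℝ) ≤ L := by exact_mod_cast hL1
  have hsr1 : (1 : ℝ) ≤ s := by exact_mod_cast hs1
  have hL0 : (0 : ℝ) < L := by linarith
  have hs0 : (0 : ℝ) < s := by linarith
  push_cast
  have hw0 : (0 : ℝ) < ((L : ℝ) * s) ^ 2 := by positivity
  rw [div_le_div_iff₀ hw0 hL0]
  -- `(j + L s) L ≤ 5 (L s)²`
  have e1 : (j : ℝ) * L ≤ 4 * (s : ℝ) ^ 2 * L := mul_le_mul_of_nonneg_right hjs hL0.le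
  have e2 : 4 * (s : ℝ) ^ 2 * L ≤ 4 * ((L : ℝ) * s) ^ 2 := by nlinarith [sq_nonneg (s : ℝ), mul_pos hL0 hs0]
  have e3 : (L : ℝ) * s * L ≤ ((L : ℝ) * s) ^ 2 := by nlinarith [mul_pos hL0 hs0]
  nlinarith

/-- **Fixed-parameter core of the composition**, relative to a class `P` of instances `(n, j, C)`: if the residual
holds on `P` at tolerance `η/100` and width `2(⌈500/η⌉₊+1)·⌊√j⌋` (the only instance the composition uses), then the crux's
conclusion holds on `P` with exponent `c₁ + 4`. -/
theorem mc_core {c c₁ k : ℕ} (hk : 3 ≤ k) {η : ℝ} (hη : 0 < η)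
    (P : (n : ℕ) → ℕ → Circuit (Edge n) → Prop)
    (hFSA : ∃ ε : ℝ, 0 < ε ∧ ∀ᶠ n : ℕ in atTop, ∀ j : ℕ, Central k n j →
      ∀ C : Circuit (Edge n), C.IsOver monotoneBasis → C.size ≤ n ^ c → P n j C →
        (∃ F : (Edge n → Bool) → Bool, Monotone F ∧ l1 n (pc n k) (ind F) (transport j (ind C.eval)) ≤ ε) →
        ∃ C₁ : Circuit (Edge n), C₁.IsOver monotoneBasis ∧ C₁.size ≤ n ^ c₁ ∧
          (∑ x ∈ slice n j, |ind C₁.eval x - ind C.eval x|) ≤ η / 100 * #(slice n j) ∧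
          ((∀ r : ℕ, r ≤ 2 * (⌈5 / (η / 100)⌉₊ + 1) * Nat.sqrt j →
              profile C₁.eval (j + r) - profile C₁.eval j ≤ η / 100) ∨
           (∀ r : ℕ, r ≤ 2 * (⌈5 / (η / 100)⌉₊ + 1) * Nat.sqrt j →
              profile C₁.eval j - profile C₁.eval (j - r) ≤ η / 100))) :
    ∃ ε : ℝ, 0 < ε ∧ ∀ᶠ n : ℕ in atTop, ∀ j : ℕ, Central k n j →
      ∀ C : Circuit (Edge n), C.IsOver monotoneBasis → C.size ≤ n ^ c → P n j C →
        (∃ F : (Edge n → Bool) → Bool, Monotone F ∧ l1 n (pc n k) (ind F) (transport j (ind C.eval)) ≤ ε) →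
        ∃ C' : Circuit (Edge n), C'.IsOver monotoneBasis ∧ C'.size ≤ n ^ (c₁ + 4) ∧
          l1 n (pc n k) (ind C'.eval) (transport j (ind C.eval)) ≤ η := by
  -- constants: `u = η/100`, `4/t ≤ u`, `5/L ≤ u`
  obtain ⟨u, hudef⟩ : ∃ u : ℝ, u = η / 100 := ⟨_, rfl⟩
  have hu0 : 0 < u := by rw [hudef]; positivity
  obtain ⟨t, htdef⟩ : ∃ t : ℕ, t = ⌈4 / u⌉₊ + 1 := ⟨_, rfl⟩
  obtain ⟨L, hLdef⟩ : ∃ L : ℕ, L = ⌈5 / u⌉₊ + 1 := ⟨_, rfl⟩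
  have ht0 : 0 < t := by rw [htdef]; exact Nat.succ_pos _
  have hL1 : 1 ≤ L := by rw [hLdef]; exact Nat.succ_le_succ (Nat.zero_le _)
  have htr : (4 : ℝ) / t ≤ u := by
    have ht0r : (0 : ℝ) < t := by exact_mod_cast ht0
    have h1 : (4 : ℝ) / u ≤ t := by
      rw [htdef]; push_cast; linarith [Nat.le_ceil (4 / u)]
    rw [div_le_iff₀ ht0r]
    rw [div_le_iff₀ hu0] at h1
    linarith
  have hLr : (5 : ℝ) / L ≤ u := by
    have hL0 : (0 : ℝ) < L := by exact_mod_cast hL1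
    have h1 : (5 : ℝ) / u ≤ L := by
      rw [hLdef]; push_cast; linarith [Nat.le_ceil (5 / u)]
    rw [div_le_iff₀ hL0]
    rw [div_le_iff₀ hu0] at h1
    linarith
  obtain ⟨εF, hεF, hevF⟩ := hFSA
  have hwidth : 2 * (⌈5 / (η / 100)⌉₊ + 1) = 2 * L := by rw [hLdef, hudef]
  refine ⟨min εF u, lt_min hεF hu0, ?_⟩
  filter_upwards [hevF, eventually_central hk L, eventually_small hk hu0, eventually_size c₁ t,
    eventually_ge_atTop 2] with n hFn hcen hsmall hsize hn2 j hj C hC hCsize hP hhyp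
  obtain ⟨F, hFmono, hFd⟩ := hhyp
  obtain ⟨hp0, hp8, hcenj⟩ := hcen
  obtain ⟨hjN, hjL, h3j⟩ := hcenj j hj
  have hp1 : pc n k ≤ 1 := by linarith
  have hplt : pc n k < 1 := by linarith
  have hFε : l1 n (pc n k) (ind F) (transport j (ind C.eval)) ≤ εF := hFd.trans (min_le_left _ _)
  have hFu : l1 n (pc n k) (transport j (ind C.eval)) (ind F) ≤ u := by
    rw [l1_comm]; exact hFd.trans (min_le_right _ _)
  -- the residual: a slice-faithful representative `C₁` with a one-sided flat profile
  obtain ⟨C₁, hC₁, hC₁size, hfaith, hflat⟩ := hFn j hj C hC hCsize hP ⟨F, hFmono, hFε⟩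
  rw [hwidth] at hflat
  replace hfaith : (∑ x ∈ slice n j, |ind C₁.eval x - ind C.eval x|) ≤ u * #(slice n j) := by rwa [hudef]
  replace hflat : (∀ r : ℕ, r ≤ 2 * L * Nat.sqrt j → profile C₁.eval (j + r) - profile C₁.eval j ≤ u) ∨
      (∀ r : ℕ, r ≤ 2 * L * Nat.sqrt j → profile C₁.eval j - profile C₁.eval (j - r) ≤ u) := by
    rw [hudef]; exact hflat
  have hf : Monotone C₁.eval := C₁.monotone_eval_of_isOver_monotoneBasis hC₁
  -- (1) contraction: `‖T_j C₁ − T_j C‖ ≤ u`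
  have hslice0 : (0 : ℝ) < #(slice n j) := by exact_mod_cast card_slice_pos hjN
  have d1 : l1 n (pc n k) (transport j (ind C₁.eval)) (transport j (ind C.eval)) ≤ u := by
    refine (l1_transport_le hp0.le hp1 j (ind C₁.eval) (ind C.eval)).trans ?_
    rw [div_le_iff₀ hslice0]
    exact hfaith
  -- (2) the window `w = L·⌊√j⌋`: `1 ≤ w ≤ j`, `j + 2w ≤ N`, tail `(j+w)/w² ≤ u`
  obtain ⟨s, hsdef⟩ : ∃ s : ℕ, s = Nat.sqrt j := ⟨_, rfl⟩
  obtain ⟨w, hwdef⟩ : ∃ w : ℕ, w = L * s := ⟨_, rfl⟩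
  have hLs : L ≤ s := by
    rw [hsdef, Nat.le_sqrt]
    have h := hjL
    rw [sq] at h
    omega
  have hs1 : 1 ≤ s := hL1.trans hLs
  have hwj : w ≤ j := by
    calc w = L * s := hwdef
      _ ≤ s * s := Nat.mul_le_mul_right _ hLs
      _ ≤ j := by rw [hsdef]; exact Nat.sqrt_le j
  have hw1 : 1 ≤ w := by rw [hwdef]; exact Nat.one_le_iff_ne_zero.2 (Nat.mul_ne_zero (by omega) (by omega))
  have hj2w : j + 2 * w ≤ n.choose 2 := by omega
  have h2w : 2 * L * Nat.sqrt j = 2 * w := by rw [hwdef, hsdef]; ring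
  have htail : ((j : ℝ) + w) / (w : ℝ) ^ 2 ≤ u := by
    have hjs : (j : ℝ) ≤ 4 * (s : ℝ) ^ 2 := by
      have h1 : j < (s + 1) * (s + 1) := by rw [hsdef]; exact Nat.lt_succ_sqrt j
      have h1' : j + 1 ≤ (s + 1) * (s + 1) := h1
      have h2 : (j : ℝ) + 1 ≤ ((s : ℝ) + 1) * ((s : ℝ) + 1) := by exact_mod_cast h1'
      have h3 : (1 : ℝ) ≤ s := by exact_mod_cast hs1
      nlinarith
    rw [hwdef]
    exact (tail_arith hL1 hs1 hjs).trans hLr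
  -- (3) the sampling mean
  have hflat2 : (∀ r : ℕ, r ≤ 2 * w → profile C₁.eval (j + r) - profile C₁.eval j ≤ u) ∨
      (∀ r : ℕ, r ≤ 2 * w → profile C₁.eval j - profile C₁.eval (j - r) ≤ u) := by
    rcases hflat with h | h
    · exact Or.inl fun r hr => h r (by rw [h2w]; exact hr)
    · exact Or.inr fun r hr => h r (by rw [h2w]; exact hr)
  obtain ⟨pstar, hps0, hps1, hbin⟩ := exists_mean hf hjN hj2w hwj hw1 hu0.le hflat2
  -- (no `linarith` while a hypothesis displays a `Finset.sum`: its preprocessing times out on it)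
  have hbin2 : ∑ r ∈ range (n.choose 2 + 1), binW (n.choose 2) pstar r *
      |profile C₁.eval r - profile C₁.eval j| ≤ 2 * u :=
    hbin.trans (by rw [two_mul]; exact add_le_add le_rfl htail)
  clear hbin
  -- (4) the sampler and (5) the circuit
  obtain ⟨σ, r, hr0, hr1, hMσ, hUσ⟩ := exists_sampler ht0 hn2 hp0 hplt C₁ hC₁ hjN hps0 hps1 hbin2
  clear hbin2
  have h3u : 2 * u + u = 3 * u := by ring
  have hU : l1 n (pc n k) (fun y => ∑ ρ, gnpWeight n r ρ * ind C₁.eval (σ y ρ)) (transport j (ind C.eval)) ≤ 3 * u :=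
    (l1_triangle hp0.le hp1 _ (transport j (ind C₁.eval)) _).trans ((add_le_add hUσ d1).trans h3u.le)
  obtain ⟨M, hMB, hMS, hMd⟩ :=
    circuit_of_sampler ht0 hp0.le hp1 σ C₁.eval hr0 hr1 hMσ (transport j (ind C.eval)) F hU hFu
  refine ⟨M, hMB, ?_, ?_⟩
  · -- size
    calc M.size ≤ t * (C₁.size + 2 * n.choose 2 + 2) + 4 * t ^ 2 + 4 := hMS
      _ ≤ t * (n ^ c₁ + 2 * n.choose 2 + 2) + 4 * t ^ 2 + 4 := by
          have := Nat.mul_le_mul_left t (Nat.add_le_add_right (Nat.add_le_add_right hC₁size (2 * n.choose 2)) 2)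
          omega
      _ ≤ n ^ (c₁ + 4) := hsize
  · -- accuracy: `w(⊥) + w(⊤) + 4/t + 5·4u + 3u ≤ 25u ≤ η`
    have hext : gnpWeight n (pc n k) (fun _ : Edge n => false) + gnpWeight n (pc n k) (fun _ : Edge n => true) ≤ u := by
      rw [gnpWeight_bot_add_top]; exact hsmall
    exact final_bound hudef hη hMd hext htr



/-! ## Registered form -/

/-- **Core of the line ProfileLine** (registered sub-goal `mcCore` of stmt-PneNP-18471): relative to any class `P` of instances,
if the residual (slice-faithful one-sided-flat representative, tolerance `η/100`, width `2(⌈500/η⌉₊+1)·⌊√j⌋`) holds on `P`, then the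
conclusion of the crux `OneSlice.MonotoneContinuation` holds on `P` with exponent `c₁ + 4`. Unconditional (the six provable stubs are
landed theorems). [folklore] -/
theorem mcCore :
  ∀ (c c₁ k : ℕ), 3 ≤ k → ∀ (η : ℝ), 0 < η → ∀ (P : (n : ℕ) → ℕ → Circuit (Edge n) → Prop),
    (∃ ε : ℝ, 0 < ε ∧ ∀ᶠ n : ℕ in atTop, ∀ j : ℕ, Central k n j →
      ∀ C : Circuit (Edge n), C.IsOver monotoneBasis → C.size ≤ n ^ c → P n j C →
        (∃ F : (Edge n → Bool) → Bool, Monotone F ∧ l1 n (pc n k) (ind F) (transport j (ind C.eval)) ≤ ε) →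
        ∃ C₁ : Circuit (Edge n), C₁.IsOver monotoneBasis ∧ C₁.size ≤ n ^ c₁ ∧
          (∑ x ∈ slice n j, |ind C₁.eval x - ind C.eval x|) ≤ η / 100 * #(slice n j) ∧
          ((∀ r : ℕ, r ≤ 2 * (⌈5 / (η / 100)⌉₊ + 1) * Nat.sqrt j →
              profile C₁.eval (j + r) - profile C₁.eval j ≤ η / 100) ∨
           (∀ r : ℕ, r ≤ 2 * (⌈5 / (η / 100)⌉₊ + 1) * Nat.sqrt j →
              profile C₁.eval j - profile C₁.eval (j - r) ≤ η / 100))) →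
    ∃ ε : ℝ, 0 < ε ∧ ∀ᶠ n : ℕ in atTop, ∀ j : ℕ, Central k n j →
      ∀ C : Circuit (Edge n), C.IsOver monotoneBasis → C.size ≤ n ^ c → P n j C →
        (∃ F : (Edge n → Bool) → Bool, Monotone F ∧ l1 n (pc n k) (ind F) (transport j (ind C.eval)) ≤ ε) →
        ∃ C' : Circuit (Edge n), C'.IsOver monotoneBasis ∧ C'.size ≤ n ^ (c₁ + 4) ∧
          l1 n (pc n k) (ind C'.eval) (transport j (ind C.eval)) ≤ η :=
  fun _ _ _ hk _ hη P hFSA => mc_core hk hη P hFSA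

end

end Summit.PneNP.PneNP.Theorems.MonotoneContinuation
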